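import Literature.Computability.MetaComplexity.OliveiraSanthanam2018.ApproxMCSPabNoSide
import Literature.Computability.Cryptography.WordRAMReadsCanonical
import Literature.Computability.Complexity.KWisePolynomialFamilyCircuits
import HarnessLib

/-!
# `(α, β)-MCSP[2^{n^γ}]` is not in randomized time `2^{(log N)^{1−ε}}` for `ε > 1 − γ`

A PROVED same-model lower bound in the regime of Oliveira–Santhanam 2018, Thm. 6
(`Literature.Computability.MetaComplexity.OliveiraSanthanam2018.thm6`): for `1/2 < β ≤ 1`,
`α ≤ 1` and a size parameter with `2^{n^{γ₀}} ≤ s(n) ≤ 2^{n^{γ₁}}` (`0 < γ₀`, `γ₁ < 1`,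
eventually), the promise problem `(α, β)-MCSP[s]` is NOT computed by any uniform two-sided-error
oracle-free word-RAM program in time `O(2^{(log N)^{1−ε}})` as soon as `1 − ε < γ₀`
(`approxMCSPab_not_mem_PrBPTIMERAM`). Thm. 6 asks for such a lower bound with `ε < 1 − γ`
(`Thm6Hypothesis`); the present file shows the complementary range `ε > 1 − γ` is a theorem, so the
magnification threshold of Thm. 6 is sharp up to the model's constants.

## The argument (folklore: bounded-query algorithms are fooled by `k`-wise independence)

Fix a program `P` with constants `k, c, δ` witnessing membership. At arity `n` all inputs
`advInput (truthTable f) []` have the same length `2ⁿ + 1`, hence the same word size `w` and time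
bound `T = c · t(2ⁿ) + c`. For each coin vector `ρ` the run is oracle-free, so by
`WordRAM.outputsWithin_iff_of_inputReadSet` its acceptance is determined by the at most `5T`
input cells it reads, and the set of cells read is stable (`WordRAM.inputReadSet_congr`): the
acceptance event is a stable reader of at most `5T` points of the cube
(`Literature.Computability.Complexity.IsStableReader`). The polynomial family
`PolyFamily.fam` with `k' = 5T` coefficients is `k'`-wise uniform (`PolyFamily.isKWiseUniform_fam`),
so for every `ρ` the number of accepted family members and of accepted functions are proportional
(`IsStableReader.card_seeds_mul_eq`); summing over `ρ`, the average acceptance probability over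
the family equals the average over all functions. Every family member has a circuit of size
`famSize n k' = O(T n³) ≤ 2^{n^{γ₀}} ≤ s(n)` (`PolyFamily.circuitSizeOver_fam_le`), so it is a
YES instance (accepted w.p. `≥ 1 − δ`), while all but `2^{c' 2ⁿ}` functions (`c' < 1`,
`eventually_card_not_mem_approxMCSPab_no_le_of_rpow`) are NO instances (accepted w.p. `≤ δ`):
`1 − δ ≤ δ + 2^{(c'−1) 2ⁿ}`, impossible for large `n` since `δ < 1/2`.

* `advWordSize_nil_congr` — the word size depends only on the input length;
* `ttReader`, `ttAccepts`, `isStableReader_tt`, `card_ttReader_le` — the reader of a run;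
* `sum_accProb_fam_mul` — the averaging identity;
* `eventually_famSize_le_two_rpow` — `famSize n (5T) ≤ 2^{n^{γ₀}}` eventually;
* **`approxMCSPab_not_mem_PrBPTIMERAM`**, **`approxMCSPab_floor_not_mem_PrBPTIMERAM`** (the
  instance `s(n) = ⌊2^{n^γ}⌋`, every `ε > 1 − γ`).

## References

* I. C. Oliveira, R. Santhanam, *Hardness magnification for natural problems*, FOCS 2018, Thm. 6
  (the regime); folklore (k-wise independence fools bounded-query algorithms; A. Joffe 1974,
  N. Alon–L. Babai–A. Itai 1986 §3 for the family).
-/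

noncomputable section

open Finset Filter Real

namespace Literature.Computability.MetaComplexity.OliveiraSanthanam2018

open Literature.Computability.Cryptography.WordRAM StateTransition
open Literature.Computability.Complexity Literature.Computability.MetaComplexity
open Literature.Computability.MetaComplexity.ChenJinWilliams2019
open Literature.Computability.Complexity.PolyFamily

/-- The bits of a Boolean string, as numbers, have maximum at most `1`. [folklore] -/
theorem foldr_max_map_toNat (x : List Bool) : (x.map Bool.toNat).foldr max 1 = 1 := by
  induction x with
  | nil => rfl
  | cons b l ih =>
    simp only [List.map_cons, List.foldr_cons, ih]
    cases b <;> rfl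

/-- The advice-free input of `x`: the length followed by the bits. [folklore] -/
theorem advInput_nil (x : List Bool) : advInput x [] = x.length :: x.map Bool.toNat := by
  simp [advInput]

/-- The advice-free word size in closed form: it depends only on `|x|`. [folklore] -/
theorem advWordSize_nil (k : ℕ) (x : List Bool) :
    advWordSize k x [] = k * Nat.size (max (x.length + 1) (max x.length 1)) := by
  rw [advWordSize, advInput_nil, inputWidth]
  simp [foldr_max_map_toNat]

/-- **The word size depends only on the input length.** [folklore] -/
theorem advWordSize_nil_congr (k : ℕ) {x x' : List Bool} (h : x.length = x'.length) :
    advWordSize k x [] = advWordSize k x' [] := by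
  rw [advWordSize_nil, advWordSize_nil, h]

/-- Word `0` of the advice-free input is the length. [folklore] -/
@[simp] theorem advInput_nil_getElem?_zero (x : List Bool) : (advInput x [])[0]? = some x.length := by
  simp [advInput_nil]

/-- Word `i + 1` of the advice-free input is bit `i`. [folklore] -/
@[simp] theorem advInput_nil_getElem?_succ (x : List Bool) (i : ℕ) :
    (advInput x [])[i + 1]? = (x[i]?).map Bool.toNat := by
  simp [advInput_nil]

/-- The advice-free input has `|x| + 1` words. [folklore] -/
@[simp] theorem length_advInput_nil (x : List Bool) : (advInput x []).length = x.length + 1 := by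
  simp [advInput_nil]

/-- Entry `j` of a truth table. [folklore] -/
theorem truthTable_getElem?_eq {n : ℕ} (f : (Fin n → Bool) → Bool) (j : ℕ) :
    (truthTable f)[j]? =
      if h : j < 2 ^ n then some (f ((boolFunEquivFin n).symm ⟨j, h⟩)) else none := by
  unfold truthTable
  rw [List.getElem?_ofFn]

/-! ### The reader of a run on a truth table -/

section Reader

variable {n : ℕ} (P : Program) (w T : ℕ)

/-- The input of the run on the truth table of `f`. [folklore] -/
abbrev ttInput (f : (Fin n → Bool) → Bool) : List ℕ := advInput (truthTable f) []

/-- The acceptance event of the run with coin vector `ρ` on the truth table of `f` (output `[1]`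
within `T` steps). [folklore] -/
def ttAccepts (ρ : Fin T → Fin (2 ^ w)) (f : (Fin n → Bool) → Bool) : Prop :=
  OutputsWithin P w noOracle (coinStream ρ) (ttInput f) [1] T

/-- The points of the cube whose truth-table cell is read by the run with coin vector `ρ` on the
truth table of `f` (cell `j + 2` holds the bit of the `j`-th point). [folklore] -/
def ttReader (ρ : Fin T → Fin (2 ^ w)) (f : (Fin n → Bool) → Bool) : Finset (Fin n → Bool) :=
  univ.filter fun z => ((boolFunEquivFin n z : ℕ) + 2) ∈
    inputReadSet P w noOracle (coinStream ρ) T (ttInput f)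

variable {P w T}

/-- All inputs at arity `n` have the same length. [folklore] -/
theorem length_ttInput (f f' : (Fin n → Bool) → Bool) :
    (ttInput f').length = (ttInput f).length := by
  simp

/-- A function agreeing with `f` on the points read yields an input agreeing with `f`'s input on
every read input word. [folklore] -/
theorem ttInput_getElem?_congr {ρ : Fin T → Fin (2 ^ w)} {f f' : (Fin n → Bool) → Bool}
    (h : ∀ z ∈ ttReader P w T ρ f, f' z = f z) :
    ∀ i, i + 1 ∈ inputReadSet P w noOracle (coinStream ρ) T (ttInput f) →
      (ttInput f')[i]? = (ttInput f)[i]? := by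
  intro i hi
  cases i with
  | zero =>
    rw [advInput_nil_getElem?_zero, advInput_nil_getElem?_zero, length_truthTable,
      length_truthTable]
  | succ j =>
    rw [advInput_nil_getElem?_succ, advInput_nil_getElem?_succ, truthTable_getElem?_eq,
      truthTable_getElem?_eq]
    by_cases hj : j < 2 ^ n
    · rw [dif_pos hj, dif_pos hj]
      have hz : (boolFunEquivFin n).symm ⟨j, hj⟩ ∈ ttReader P w T ρ f := by
        rw [ttReader, mem_filter]
        exact ⟨mem_univ _, by simpa using hi⟩
      rw [h _ hz]
    · rw [dif_neg hj, dif_neg hj]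

/-- Inputs at one arity differ only beyond the output cell. [folklore] -/
theorem ttInput_out (f f' : (Fin n → Bool) → Bool) :
    ∀ i, (ttInput f')[i]? ≠ (ttInput f)[i]? → ([1] : List ℕ).length ≤ i := by
  intro i hne
  cases i with
  | zero =>
    exfalso
    apply hne
    rw [advInput_nil_getElem?_zero, advInput_nil_getElem?_zero, length_truthTable,
      length_truthTable]
  | succ j => simp

/-- **The acceptance event of an oracle-free run is a stable reader** of the points whose cells
it reads. [folklore] -/
theorem isStableReader_tt (hP : P.IsOracleFree) (ρ : Fin T → Fin (2 ^ w)) :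
    IsStableReader (ttReader (n := n) P w T ρ) (ttAccepts P w T ρ) where
  stable f f' h := by
    have hR := inputReadSet_congr hP (length_ttInput f f') (ttInput_getElem?_congr h)
    ext z
    simp only [ttReader, mem_filter, mem_univ, true_and, hR]
  determined f f' h :=
    outputsWithin_iff_of_inputReadSet hP (length_ttInput f f') (ttInput_getElem?_congr h)
      (ttInput_out f f')

/-- The reader has at most `5 T` points. [folklore] -/
theorem card_ttReader_le (ρ : Fin T → Fin (2 ^ w)) (f : (Fin n → Bool) → Bool) :
    (ttReader P w T ρ f).card ≤ 5 * T := by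
  calc (ttReader P w T ρ f).card
      ≤ (inputReadSet P w noOracle (coinStream ρ) T (ttInput f)).card :=
        Finset.card_le_card_of_injOn (fun z => (boolFunEquivFin n z : ℕ) + 2)
          (fun z hz => by simpa [ttReader] using hz)
          (fun z _ z' _ hzz => by
            have : (boolFunEquivFin n z : ℕ) = boolFunEquivFin n z' := by simpa using hzz
            exact (boolFunEquivFin n).injective (Fin.ext this))
    _ ≤ 5 * T := card_inputReadSet_le _ _ _ _ _ _

open scoped Classical in
/-- The success probability with target `{[1]}` is the fraction of accepting coin vectors. [folklore] -/
theorem successProb_ttInput_eq (f : (Fin n → Bool) → Bool) :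
    successProb P w noOracle (ttInput f) {[1]} T =
      ((#{ρ : Fin T → Fin (2 ^ w) | ttAccepts P w T ρ f} : ℕ) : ℝ) / ((2 : ℝ) ^ w) ^ T := by
  classical
  unfold successProb ttAccepts
  congr 2
  · apply Finset.card_bij (fun ρ _ => ρ)
    · intro ρ hρ
      simp only [mem_filter, mem_univ, true_and, Set.mem_singleton_iff, exists_eq_left] at hρ ⊢
      exact hρ
    · intro _ _ _ _ h; exact h
    · intro ρ hρ
      refine ⟨ρ, ?_, rfl⟩
      simp only [mem_filter, mem_univ, true_and, Set.mem_singleton_iff, exists_eq_left] at hρ ⊢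
      exact hρ

end Reader

/-! ### Averaging over the polynomial family -/

/-- Double counting: summing fibre sizes either way. [folklore] -/
theorem sum_card_filter_comm {ι κ : Type*} [Fintype ι] [Fintype κ] (p : ι → κ → Prop)
    [∀ a b, Decidable (p a b)] :
    ∑ a, #{b : κ | p a b} = ∑ b, #{a : ι | p a b} := by
  simp_rw [Finset.card_filter]
  exact Finset.sum_comm

/-- There are `2^{2ⁿ}` Boolean functions on `n` bits. [folklore] -/
theorem card_boolFun (n : ℕ) : Fintype.card ((Fin n → Bool) → Bool) = 2 ^ 2 ^ n := by
  simp

open scoped Classical in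
/-- **For each coin vector, accepted family members and accepted functions are proportional**
(`k'`-wise uniformity of the family, `5 T ≤ k'`). [folklore] -/
theorem card_fam_ttAccepts_mul {n : ℕ} (hn : n ≠ 0) {P : Program} (hP : P.IsOracleFree)
    {w T k' : ℕ} (hk : 5 * T ≤ k') (ρ : Fin T → Fin (2 ^ w)) :
    #{a : Fin k' → 𝔽 n | ttAccepts P w T ρ (fam hn k' a)} * 2 ^ 2 ^ n =
      #{f : (Fin n → Bool) → Bool | ttAccepts P w T ρ f} * Fintype.card (Fin k' → 𝔽 n) := by
  have h := (isStableReader_tt (n := n) hP ρ).card_seeds_mul_eq (k := k')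
    (fun f => (card_ttReader_le ρ f).trans hk) (isKWiseUniform_fam hn k')
  simpa [Fintype.card_fun] using h

open scoped Classical in
/-- Summed over the coin vectors (counts). [folklore] -/
theorem sum_card_ttAccepts_fam_mul {n : ℕ} (hn : n ≠ 0) {P : Program} (hP : P.IsOracleFree)
    {w T k' : ℕ} (hk : 5 * T ≤ k') :
    (∑ a : Fin k' → 𝔽 n, #{ρ : Fin T → Fin (2 ^ w) | ttAccepts P w T ρ (fam hn k' a)}) *
        2 ^ 2 ^ n =
      (∑ f : (Fin n → Bool) → Bool, #{ρ : Fin T → Fin (2 ^ w) | ttAccepts P w T ρ f}) *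
        Fintype.card (Fin k' → 𝔽 n) := by
  rw [sum_card_filter_comm (fun (a : Fin k' → 𝔽 n) (ρ : Fin T → Fin (2 ^ w)) =>
      ttAccepts P w T ρ (fam hn k' a)),
    sum_card_filter_comm (fun (f : (Fin n → Bool) → Bool) (ρ : Fin T → Fin (2 ^ w)) =>
      ttAccepts P w T ρ f), Finset.sum_mul, Finset.sum_mul]
  exact Finset.sum_congr rfl fun ρ _ => card_fam_ttAccepts_mul hn hP hk ρ

/-- **The averaging identity**: (sum of the acceptance probabilities over the family) · `2^{2ⁿ}`
= (sum over all functions) · (number of seeds). [folklore] -/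
theorem sum_accProb_fam_mul {n : ℕ} (hn : n ≠ 0) {P : Program} (hP : P.IsOracleFree)
    {w T k' : ℕ} (hk : 5 * T ≤ k') :
    (∑ a : Fin k' → 𝔽 n, successProb P w noOracle (ttInput (fam hn k' a)) {[1]} T) *
        (2 : ℝ) ^ 2 ^ n =
      (∑ f : (Fin n → Bool) → Bool, successProb P w noOracle (ttInput f) {[1]} T) *
        Fintype.card (Fin k' → 𝔽 n) := by
  classical
  simp_rw [successProb_ttInput_eq]
  rw [← Finset.sum_div, ← Finset.sum_div, div_mul_eq_mul_div, div_mul_eq_mul_div]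
  congr 1
  have h := sum_card_ttAccepts_fam_mul hn hP hk (w := w)
  have h' := congrArg (fun m : ℕ => (m : ℝ)) h
  push_cast at h'
  exact h'

/-! ### Asymptotics -/

/-- `K + 3 log₂ x + x^a ≤ x^b` for large real `x`, when `a < b` and `0 < b`. [folklore] -/
theorem eventually_const_add_log_add_rpow_le {a b : ℝ} (hab : a < b) (hb : 0 < b) (K : ℝ) :
    ∀ᶠ x : ℝ in atTop, K + 3 * Real.logb 2 x + x ^ a ≤ x ^ b := by
  have hlog2 : 0 < Real.log 2 := Real.log_pos one_lt_two
  -- `x^a ≤ x^b / 2`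
  have h1 : ∀ᶠ x : ℝ in atTop, x ^ a ≤ x ^ b / 2 := by
    have hlim := tendsto_rpow_neg_atTop (show 0 < b - a by linarith)
    filter_upwards [(tendsto_order.1 hlim).2 _ (by norm_num : (0 : ℝ) < 1 / 2),
      eventually_gt_atTop 0] with x hx hx0
    have : x ^ a = x ^ (-(b - a)) * x ^ b := by
      rw [← Real.rpow_add hx0]; ring_nf
    rw [this]
    have hb0 : 0 < x ^ b := Real.rpow_pos_of_pos hx0 b
    nlinarith
  -- `3 log₂ x ≤ x^b / 4`
  have h2 : ∀ᶠ x : ℝ in atTop, 3 * Real.logb 2 x ≤ x ^ b / 4 := by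
    have hc : 0 < Real.log 2 / 12 := by positivity
    filter_upwards [(isLittleO_log_rpow_atTop hb).def hc, eventually_ge_atTop 1] with x hx hx1
    have hx0 : 0 < x := by linarith
    rw [Real.norm_eq_abs, Real.norm_eq_abs, abs_of_nonneg (Real.log_nonneg hx1),
      abs_of_pos (Real.rpow_pos_of_pos hx0 b)] at hx
    rw [Real.logb, ← le_div_iff₀' (by norm_num : (0 : ℝ) < 3), div_le_iff₀ hlog2]
    nlinarith
  -- `K ≤ x^b / 4`
  have h3 : ∀ᶠ x : ℝ in atTop, K ≤ x ^ b / 4 := by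
    filter_upwards [(tendsto_rpow_atTop hb).eventually_ge_atTop (4 * K)] with x hx
    linarith
  filter_upwards [h1, h2, h3] with x e1 e2 e3
  linarith

/-- `C · n³ · 2^{n^a} ≤ 2^{n^b}` for large `n`, when `a < b` and `0 < b`. [folklore] -/
theorem eventually_mul_cube_mul_two_rpow_le {a b C : ℝ} (hab : a < b) (hb : 0 < b) (hC : 0 < C) :
    ∀ᶠ n : ℕ in atTop, C * (n : ℝ) ^ 3 * (2 : ℝ) ^ ((n : ℝ) ^ a) ≤ (2 : ℝ) ^ ((n : ℝ) ^ b) := by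
  have hev := tendsto_natCast_atTop_atTop.eventually
    (eventually_const_add_log_add_rpow_le hab hb (Real.logb 2 C))
  filter_upwards [hev, eventually_ge_atTop 1] with n hn hn1
  have hn0 : (0 : ℝ) < n := by exact_mod_cast hn1
  have hC' : C = (2 : ℝ) ^ Real.logb 2 C := (Real.rpow_logb two_pos (by norm_num) hC).symm
  have hn3 : (n : ℝ) ^ 3 = (2 : ℝ) ^ (3 * Real.logb 2 n) := by
    rw [mul_comm, Real.rpow_mul (by norm_num : (0 : ℝ) ≤ 2), Real.rpow_logb two_pos (by norm_num) hn0]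
    norm_cast
  rw [hC', hn3, ← Real.rpow_add two_pos, ← Real.rpow_add two_pos]
  exact Real.rpow_le_rpow_of_exponent_le one_le_two hn

/-- `2^{n^{1−ε}} ≥ 1`. [folklore] -/
theorem one_le_two_rpow_rpow (n : ℕ) (e : ℝ) : (1 : ℝ) ≤ (2 : ℝ) ^ ((n : ℝ) ^ e) := by
  rw [← Real.rpow_zero 2]
  exact Real.rpow_le_rpow_of_exponent_le one_le_two (Real.rpow_nonneg (Nat.cast_nonneg n) e)

/-- **The family fits the size budget**: with `T = c · t(2ⁿ) + c`, `t = ⌈2^{(log N)^{1−ε}}⌉`,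
eventually `famSize n (5 T) ≤ 2^{n^{γ₀}}` whenever `1 − ε < γ₀` and `0 < γ₀`. [folklore] -/
theorem eventually_famSize_le_two_rpow (c : ℕ) {ε γ₀ : ℝ} (hγ₀ : 0 < γ₀) (hεγ : 1 - ε < γ₀) :
    ∀ᶠ n : ℕ in atTop,
      (famSize n (5 * (c * sublinearTime ε (2 ^ n) + c)) : ℝ) ≤ (2 : ℝ) ^ ((n : ℝ) ^ γ₀) := by
  have hC : (0 : ℝ) < 4 * (15 * c + 1) := by positivity
  filter_upwards [eventually_mul_cube_mul_two_rpow_le hεγ hγ₀ hC, eventually_ge_atTop 1]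
    with n hn hn1
  set y : ℝ := (2 : ℝ) ^ ((n : ℝ) ^ (1 - ε)) with hy
  have hy1 : 1 ≤ y := one_le_two_rpow_rpow n (1 - ε)
  have ht : (sublinearTime ε (2 ^ n) : ℝ) ≤ y + 1 := by
    rw [sublinearTime_two_pow]
    exact (Nat.ceil_lt_add_one (by positivity)).le
  have hfs : (famSize n (5 * (c * sublinearTime ε (2 ^ n) + c)) : ℝ) ≤
      4 * ((5 * (c * sublinearTime ε (2 ^ n) + c) : ℕ) + 1) * (n : ℝ) ^ 3 := by
    exact_mod_cast famSize_le hn1 _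
  have hc0 : (0 : ℝ) ≤ c := Nat.cast_nonneg c
  have hn3 : (0 : ℝ) ≤ (n : ℝ) ^ 3 := by positivity
  calc (famSize n (5 * (c * sublinearTime ε (2 ^ n) + c)) : ℝ)
      ≤ 4 * ((5 * (c * sublinearTime ε (2 ^ n) + c) : ℕ) + 1) * (n : ℝ) ^ 3 := hfs
    _ ≤ 4 * (15 * c + 1) * (n : ℝ) ^ 3 * y := by
        push_cast
        have : (5 : ℝ) * (c * sublinearTime ε (2 ^ n) + c) + 1 ≤ (15 * c + 1) * y := by
          nlinarith
        nlinarith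
    _ ≤ (2 : ℝ) ^ ((n : ℝ) ^ γ₀) := hn

/-- `2^{c' M} < η · 2^{M}` at `M = 2ⁿ` for large `n`, when `c' < 1` and `η > 0`. [folklore] -/
theorem eventually_two_rpow_lt_mul_two_pow {c' η : ℝ} (hc' : c' < 1) (hη : 0 < η) :
    ∀ᶠ n : ℕ in atTop, (2 : ℝ) ^ (c' * (2 ^ n : ℕ)) < η * (2 : ℝ) ^ (2 ^ n : ℕ) := by
  -- `b^n → ∞` for `b = 2^{1-c'} > 1`, and `2^{(1-c') 2ⁿ} ≥ b^n`
  have hb : (1 : ℝ) < (2 : ℝ) ^ (1 - c') := Real.one_lt_rpow one_lt_two (by linarith)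
  have hlim := tendsto_pow_atTop_atTop_of_one_lt hb
  filter_upwards [hlim.eventually_gt_atTop (1 / η)] with n hn
  have hM : (n : ℝ) ≤ ((2 ^ n : ℕ) : ℝ) := by exact_mod_cast (Nat.lt_two_pow_self).le
  have h1 : ((2 : ℝ) ^ (1 - c')) ^ n ≤ (2 : ℝ) ^ ((1 - c') * (2 ^ n : ℕ)) := by
    rw [← Real.rpow_natCast, ← Real.rpow_mul (by norm_num : (0 : ℝ) ≤ 2)]
    exact Real.rpow_le_rpow_of_exponent_le one_le_two
      (mul_le_mul_of_nonneg_left hM (by linarith))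
  have h2 : 1 / η < (2 : ℝ) ^ ((1 - c') * (2 ^ n : ℕ)) := lt_of_lt_of_le hn h1
  have hsplit : (2 : ℝ) ^ (2 ^ n : ℕ) =
      (2 : ℝ) ^ (c' * (2 ^ n : ℕ)) * (2 : ℝ) ^ ((1 - c') * (2 ^ n : ℕ)) := by
    rw [← Real.rpow_add two_pos, ← Real.rpow_natCast]
    ring_nf
  rw [hsplit]
  have hA : 0 < (2 : ℝ) ^ (c' * (2 ^ n : ℕ)) := Real.rpow_pos_of_pos two_pos _
  have h3 : 1 < η * (2 : ℝ) ^ ((1 - c') * (2 ^ n : ℕ)) := by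
    rw [div_lt_iff₀ hη] at h2; linarith
  nlinarith

/-! ### The lower bound -/

open scoped Classical in
/-- **Same-model lower bound in the regime of Thm. 6.** For `α ≤ 1`, `1/2 < β ≤ 1`, `0 < γ₀`,
`γ₁ < 1`, a size parameter with `2^{n^{γ₀}} ≤ s(n) ≤ 2^{n^{γ₁}}` eventually, and every `ε` with
`1 − ε < γ₀`: `(α, β)-MCSP[s] ∉ PrBPTIMERAM(⌈2^{(log₂ N)^{1−ε}}⌉)`. PROVED (k-wise independence
fools bounded-read oracle-free word-RAM runs). [folklore] -/
theorem approxMCSPab_not_mem_PrBPTIMERAM {α β ε γ₀ γ₁ : ℝ} {s : ℕ → ℕ} (hα1 : α ≤ 1)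
    (hβ : 1 / 2 < β) (hβ1 : β ≤ 1) (hγ₀ : 0 < γ₀) (hεγ : 1 - ε < γ₀) (hγ₁ : γ₁ < 1)
    (hs_lo : ∀ᶠ n : ℕ in atTop, (2 : ℝ) ^ ((n : ℝ) ^ γ₀) ≤ s n)
    (hs_hi : ∀ᶠ n : ℕ in atTop, (s n : ℝ) ≤ (2 : ℝ) ^ ((n : ℝ) ^ γ₁)) :
    approxMCSPab α β s ∉ PrBPTIMERAM (sublinearTime ε) := by
  rintro ⟨P, k, c, δ, hδ, hP, hrun⟩
  -- an exponent `c'` with `h(1-β) < c' < 1`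
  obtain ⟨c', hc'lo, hc'hi⟩ := exists_between (binEntropy_div_log_two_lt_one hβ)
  have hη : 0 < 1 - 2 * δ := by linarith
  have E1 := eventually_card_not_mem_approxMCSPab_no_le_of_rpow α hβ hβ1 hγ₁ hc'lo hs_hi
  have E2 := eventually_famSize_le_two_rpow c hγ₀ hεγ
  have E3 := eventually_two_rpow_lt_mul_two_pow hc'hi hη
  obtain ⟨n, hE1, hE2, hE3, hslo, hn1⟩ :=
    (E1.and (E2.and (E3.and (hs_lo.and (eventually_ge_atTop 1))))).exists
  have hn : n ≠ 0 := by omega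
  -- the data at arity `n`
  set T : ℕ := c * sublinearTime ε (2 ^ n) + c with hT
  set k' : ℕ := 5 * T with hk'
  set f₀ : (Fin n → Bool) → Bool := fun _ => false with hf₀
  set w : ℕ := advWordSize k (truthTable f₀) [] with hw
  have hwf : ∀ f : (Fin n → Bool) → Bool, advWordSize k (truthTable f) [] = w := fun f =>
    advWordSize_nil_congr k (by simp)
  have hacc : ∀ f : (Fin n → Bool) → Bool,
      advAcceptProb P k (truthTable f) [] (c * sublinearTime ε (truthTable f).length + c) =
        successProb P w noOracle (ttInput f) {[1]} T := by
    intro f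
    rw [advAcceptProb, hwf f, length_truthTable]
  -- YES: every family member is accepted with probability ≥ 1 - δ
  have hsize : ∀ a : Fin k' → 𝔽 n, circuitSizeOver B2 (fam hn k' a) ≤ s n := by
    intro a
    have h1 := circuitSizeOver_fam_le hn k' a
    have h2 : (famSize n k' : ℝ) ≤ s n := hE2.trans hslo
    exact h1.trans (by exact_mod_cast h2)
  have hyes : ∀ a : Fin k' → 𝔽 n,
      1 - δ ≤ successProb P w noOracle (ttInput (fam hn k' a)) {[1]} T := by
    intro a
    rw [← hacc]
    refine (hrun (truthTable (fam hn k' a))).2.1 ?_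
    refine (truthTable_mem_approxMCSPab_yes_iff α β s _).2 ⟨fam hn k' a, hsize a, ?_⟩
    rw [agree_self]; push_cast
    have : (0 : ℝ) ≤ (2 : ℝ) ^ n := by positivity
    nlinarith
  -- NO: every NO instance is accepted with probability ≤ δ; hence every function with
  -- probability ≤ δ + [not NO]
  have hδ0 : 0 ≤ δ := by
    have h := hyes (fun _ => 0)
    have h1 := successProb_le_one P w noOracle (ttInput (fam hn k' (fun _ => 0))) {[1]} T
    linarith
  have hno : ∀ f : (Fin n → Bool) → Bool, successProb P w noOracle (ttInput f) {[1]} T ≤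
      δ + (if truthTable f ∉ (approxMCSPab α β s).no then 1 else 0) := by
    intro f
    by_cases hf : truthTable f ∈ (approxMCSPab α β s).no
    · rw [if_neg (not_not.2 hf), add_zero, ← hacc]
      exact (hrun (truthTable f)).2.2 hf
    · rw [if_pos hf]
      have := successProb_le_one P w noOracle (ttInput f) {[1]} T
      linarith
  -- sums
  set Sd : ℝ := (Fintype.card (Fin k' → 𝔽 n) : ℝ) with hSd
  set F : ℝ := (2 : ℝ) ^ 2 ^ n with hF
  have hSd0 : 0 < Sd := by rw [hSd]; exact_mod_cast Fintype.card_pos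
  have hF0 : 0 < F := by positivity
  have hsumA : Sd * (1 - δ) ≤
      ∑ a : Fin k' → 𝔽 n, successProb P w noOracle (ttInput (fam hn k' a)) {[1]} T := by
    calc Sd * (1 - δ) = ∑ _a : Fin k' → 𝔽 n, (1 - δ) := by
          rw [Finset.sum_const, nsmul_eq_mul, Finset.card_univ]
      _ ≤ _ := Finset.sum_le_sum fun a _ => hyes a
  have hsumF : ∑ f : (Fin n → Bool) → Bool, successProb P w noOracle (ttInput f) {[1]} T ≤
      F * δ + (2 : ℝ) ^ (c' * (2 ^ n : ℕ)) := by
    calc ∑ f : (Fin n → Bool) → Bool, successProb P w noOracle (ttInput f) {[1]} T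
        ≤ ∑ f : (Fin n → Bool) → Bool,
            (δ + (if truthTable f ∉ (approxMCSPab α β s).no then (1 : ℝ) else 0)) :=
          Finset.sum_le_sum fun f _ => hno f
      _ = F * δ + ((#{f : (Fin n → Bool) → Bool | truthTable f ∉ (approxMCSPab α β s).no} : ℕ) : ℝ) := by
          rw [Finset.sum_add_distrib, Finset.sum_const, nsmul_eq_mul, Finset.card_univ,
            card_boolFun, Finset.sum_boole]
          push_cast; ring
      _ ≤ F * δ + (2 : ℝ) ^ (c' * (2 ^ n : ℕ)) := by linarith [hE1]
  -- the averaging identity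
  have hid := sum_accProb_fam_mul hn hP (le_refl k') (w := w) (T := T)
  -- combine: `Sd (1-δ) F ≤ (F δ + 2^{c' 2ⁿ}) Sd`
  have hmain : Sd * (1 - δ) * F ≤ (F * δ + (2 : ℝ) ^ (c' * (2 ^ n : ℕ))) * Sd := by
    calc Sd * (1 - δ) * F
        ≤ (∑ a : Fin k' → 𝔽 n, successProb P w noOracle (ttInput (fam hn k' a)) {[1]} T) * F :=
          mul_le_mul_of_nonneg_right hsumA hF0.le
      _ = (∑ f : (Fin n → Bool) → Bool, successProb P w noOracle (ttInput f) {[1]} T) * Sd := hid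
      _ ≤ _ := mul_le_mul_of_nonneg_right hsumF hSd0.le
  have hmain' : (1 - δ) * F ≤ F * δ + (2 : ℝ) ^ (c' * (2 ^ n : ℕ)) := by
    have := hmain
    nlinarith
  -- contradiction with `2^{c' 2ⁿ} < (1 - 2δ) F`
  linarith

/-- `⌊2^{n^γ}⌋ ≥ 2^{n^{γ₀}}` eventually for `γ₀ < γ`, `0 < γ`. [folklore] -/
theorem eventually_two_rpow_le_floor {γ₀ γ : ℝ} (hγ : γ₀ < γ) (hγ0 : 0 < γ) :
    ∀ᶠ n : ℕ in atTop, (2 : ℝ) ^ ((n : ℝ) ^ γ₀) ≤ (⌊(2 : ℝ) ^ ((n : ℝ) ^ γ)⌋₊ : ℕ) := by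
  filter_upwards [eventually_mul_cube_mul_two_rpow_le hγ hγ0 (by norm_num : (0 : ℝ) < 2),
    eventually_ge_atTop 1] with n hn hn1
  have hn3 : (1 : ℝ) ≤ (n : ℝ) ^ 3 := by exact_mod_cast Nat.one_le_pow 3 n hn1
  have h0 : 0 ≤ (2 : ℝ) ^ ((n : ℝ) ^ γ₀) := by positivity
  have h1 := one_le_two_rpow_rpow n γ₀
  have hfl := (Nat.lt_floor_add_one ((2 : ℝ) ^ ((n : ℝ) ^ γ))).le
  have h2 : 2 * (2 : ℝ) ^ ((n : ℝ) ^ γ₀) ≤ (2 : ℝ) ^ ((n : ℝ) ^ γ) := by nlinarith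
  linarith

/-- **The instance of the census row:** for `1/2 < β ≤ 1`, `α ≤ 1`, `0 < γ < 1` and every
`ε > 1 − γ`, `(α, β)-MCSP[⌊2^{n^γ}⌋] ∉ PrBPTIMERAM(⌈2^{(log₂ N)^{1−ε}}⌉)` — the range of `ε`
complementary to the hypothesis of Thm. 6 (`ε < 1 − γ`) is a theorem in the same model. [folklore] -/
theorem approxMCSPab_floor_not_mem_PrBPTIMERAM {α β γ ε : ℝ} (hα1 : α ≤ 1) (hβ : 1 / 2 < β)
    (hβ1 : β ≤ 1) (hγ0 : 0 < γ) (hγ1 : γ < 1) (hε : 1 - γ < ε) :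
    approxMCSPab α β (fun n => ⌊(2 : ℝ) ^ ((n : ℝ) ^ γ)⌋₊) ∉ PrBPTIMERAM (sublinearTime ε) := by
  obtain ⟨γ₀, hγ₀lo, hγ₀hi⟩ := exists_between (show max (1 - ε) 0 < γ by
    exact max_lt (by linarith) hγ0)
  refine approxMCSPab_not_mem_PrBPTIMERAM (γ₀ := γ₀) (γ₁ := γ) hα1 hβ hβ1
    (lt_of_le_of_lt (le_max_right _ _) hγ₀lo) (lt_of_le_of_lt (le_max_left _ _) hγ₀lo) hγ1
    (eventually_two_rpow_le_floor hγ₀hi hγ0) (Eventually.of_forall fun n => Nat.floor_le (by positivity))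

end Literature.Computability.MetaComplexity.OliveiraSanthanam2018
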